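import Summits.Ventures.PercRepro.S2TopHitSeven
import Summits.Ventures.PercRepro.S2MaxExtensionPairs

/-!
# PercRepro — S2: THE TOP `7`-SETS CHARGED TO THEIR TOP `6`-SUBSETS (p7, gen 14; sub-claim S2; the spread case of `(14, 7)`)

A top `7`-set `B` (`ρ(B) = 5`, `E ∖ B` spanning) has at most two points `x` with `ρ(B ∖ {x}) = 4` (three such points would leave `4` points of
rank `2`), so at least five `6`-subsets `B ∖ {x}` of rank `5` — each a top `6`-set, its complement a superset of `E ∖ B`; and a top `6`-set `B′`
extends to at most `|cl B′ ∖ B′| ≤ 2` top `7`-sets when rank-`5` sets have `≤ 8` points: **`ncard_top_seven_mul_five_le`** —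
`5·#{top 7-sets} ≤ 2·#{top 6-sets}` (`Finset.card_mul_le_card_mul`; lines have `≤ 3` points). With the hitting lever on the top `6`-sets this charges the `7`-sets of the
spread case of `(14, 7)` at `2/5` of the LEVERED `6`-set count. Axioms: standard.
-/

open scoped Matroid

namespace PercRepro

namespace S2

open Set

variable {α : Type}

open scoped Classical in
/-- **The top `7`-sets against the top `6`-sets**: `5·#top7 ≤ 2·#top6` when rank-`5` sets have `≤ 8` points and lines `≤ 3` points. -/
theorem ncard_top_seven_mul_five_le (M : Matroid α) [M.Finite]
    (hC1 : ∀ L ⊆ M.E, M.eRk L = 2 → L.ncard ≤ 3)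
    (hflat : ∀ X ⊆ M.E, M.eRk X ≤ 5 → X.ncard ≤ 8) :
    {B : Set α | B ⊆ M.E ∧ B.ncard = 7 ∧ M.eRk B = 5 ∧ M.eRk (M.E \ B) = M.eRank}.ncard * 5 ≤
      {B : Set α | B ⊆ M.E ∧ B.ncard = 6 ∧ M.eRk B = 5 ∧ M.eRk (M.E \ B) = M.eRank}.ncard * 2 := by
  have hEfin : M.E.Finite := M.ground_finite
  set Ef : Finset α := hEfin.toFinset with hEf
  have hEfc : (Ef : Set α) = M.E := Set.Finite.coe_toFinset _
  set s : Finset (Set α) := (Matroid.subsF Ef 7).filter (fun B => M.eRk B = 5 ∧ M.eRk (M.E \ B) = M.eRank) with hsdef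
  set t : Finset (Set α) := (Matroid.subsF Ef 6).filter (fun B => M.eRk B = 5 ∧ M.eRk (M.E \ B) = M.eRank) with htdef
  have hmem_s : ∀ B, B ∈ s ↔ B ⊆ M.E ∧ B.ncard = 7 ∧ M.eRk B = 5 ∧ M.eRk (M.E \ B) = M.eRank := by
    intro B
    rw [hsdef, Finset.mem_filter, mem_subsF_iff, hEfc]
    tauto
  have hmem_t : ∀ B, B ∈ t ↔ B ⊆ M.E ∧ B.ncard = 6 ∧ M.eRk B = 5 ∧ M.eRk (M.E \ B) = M.eRank := by
    intro B
    rw [htdef, Finset.mem_filter, mem_subsF_iff, hEfc]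
    tauto
  have hcard_s : {B : Set α | B ⊆ M.E ∧ B.ncard = 7 ∧ M.eRk B = 5 ∧ M.eRk (M.E \ B) = M.eRank}.ncard = s.card := by
    rw [← Set.ncard_coe_finset s]
    congr 1
    ext B
    rw [Finset.mem_coe, hmem_s]
    rfl
  have hcard_t : {B : Set α | B ⊆ M.E ∧ B.ncard = 6 ∧ M.eRk B = 5 ∧ M.eRk (M.E \ B) = M.eRank}.ncard = t.card := by
    rw [← Set.ncard_coe_finset t]
    congr 1
    ext B
    rw [Finset.mem_coe, hmem_t]
    rfl
  rw [hcard_s, hcard_t]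
  refine Finset.card_mul_le_card_mul (fun (B : Set α) (B' : Set α) => B' ⊆ B) ?_ ?_
  · -- each top `7`-set has at least five top `6`-subsets
    intro B hB
    obtain ⟨hBE, hB7, hB5, hBs⟩ := (hmem_s B).1 hB
    have hBfin : B.Finite := hEfin.subset hBE
    -- the points whose removal keeps the rank: at least five
    have hdrop : ∀ x ∈ B, M.eRk (B \ {x}) ≠ 5 → x ∉ M.closure (B \ {x}) := by
      intro x hx hne hxcl
      apply hne
      have h := eRk_insert_eq_of_mem_closure (M := M) hxcl
      rw [Set.insert_sdiff_singleton, Set.insert_eq_of_mem hx] at h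
      rw [← h, hB5]
    have hgood : 5 ≤ (hBfin.toFinset.filter (fun x => M.eRk (B \ {x}) = 5)).card := by
      by_contra hlt
      push Not at hlt
      have hbad : 2 < (hBfin.toFinset.filter (fun x => ¬ M.eRk (B \ {x}) = 5)).card := by
        have h := Finset.card_filter_add_card_filter_not (s := hBfin.toFinset) (fun x => M.eRk (B \ {x}) = 5)
        rw [← Set.ncard_eq_toFinset_card B hBfin, hB7] at h
        omega
      obtain ⟨x, y, z, hx, hy, hz, hxy, hxz, hyz⟩ := Finset.two_lt_card_iff.1 hbad
      rw [Finset.mem_filter, Set.Finite.mem_toFinset] at hx hy hz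
      have hxcl := hdrop x hx.1 hx.2
      have hycl := hdrop y hy.1 hy.2
      have hzcl := hdrop z hz.1 hz.2
      -- `ρ(B ∖ {x, y, z}) = 2` on four points
      set D := B \ {x, y, z} with hD
      have hDE : D ⊆ M.E := sdiff_subset.trans hBE
      have hxD : x ∉ D := fun h => h.2 (Or.inl rfl)
      have hyD : y ∉ D := fun h => h.2 (Or.inr (Or.inl rfl))
      have hzD : z ∉ D := fun h => h.2 (Or.inr (Or.inr rfl))
      have h1 : insert z D = B \ {x, y} := by
        ext w
        simp only [hD, Set.mem_insert_iff, Set.mem_sdiff, Set.mem_singleton_iff]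
        constructor
        · rintro (rfl | ⟨hw, hw'⟩)
          · exact ⟨hz.1, fun h => h.elim (fun h => hxz h.symm) (fun h => hyz h.symm)⟩
          · exact ⟨hw, fun h => hw' (h.elim (fun h => Or.inl h) (fun h => Or.inr (Or.inl h)))⟩
        · rintro ⟨hw, hw'⟩
          by_cases hwz : w = z
          · exact Or.inl hwz
          · exact Or.inr ⟨hw, fun h => h.elim (fun h => hw' (Or.inl h)) (fun h => h.elim (fun h => hw' (Or.inr h)) hwz)⟩
      have h2 : insert y (B \ {x, y}) = B \ {x} := by
        ext w
        simp only [Set.mem_insert_iff, Set.mem_sdiff, Set.mem_singleton_iff]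
        constructor
        · rintro (rfl | ⟨hw, hw'⟩)
          · exact ⟨hy.1, fun h => hxy h.symm⟩
          · exact ⟨hw, fun h => hw' (Or.inl h)⟩
        · rintro ⟨hw, hw'⟩
          by_cases hwy : w = y
          · exact Or.inl hwy
          · exact Or.inr ⟨hw, fun h => h.elim hw' hwy⟩
      have h3 : insert x (B \ {x}) = B := by
        rw [Set.insert_sdiff_singleton, Set.insert_eq_of_mem hx.1]
      have hr1 : M.eRk (B \ {x}) + 1 = 5 := by
        have := Matroid.eRk_insert_eq_add_one (M := M) (e := x) (X := B \ {x}) ⟨hBE hx.1, hxcl⟩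
        rw [h3, hB5] at this
        exact this.symm
      have hr2 : M.eRk (B \ {x, y}) + 1 = M.eRk (B \ {x}) := by
        have hsub2 : B \ {x, y} ⊆ B \ {y} := fun w hw => ⟨hw.1, fun h' => hw.2 (Or.inr h')⟩
        have hycl' : y ∉ M.closure (B \ {x, y}) := fun h => hycl (M.closure_subset_closure hsub2 h)
        have := Matroid.eRk_insert_eq_add_one (M := M) (e := y) (X := B \ {x, y}) ⟨hBE hy.1, hycl'⟩
        rw [h2] at this
        exact this.symm
      have hr3 : M.eRk D + 1 = M.eRk (B \ {x, y}) := by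
        have hsub3 : D ⊆ B \ {z} := fun w hw => ⟨hw.1, fun h' => hw.2 (Or.inr (Or.inr h'))⟩
        have hzcl' : z ∉ M.closure D := fun h => hzcl (M.closure_subset_closure hsub3 h)
        have := Matroid.eRk_insert_eq_add_one (M := M) (e := z) (X := D) ⟨hBE hz.1, hzcl'⟩
        rw [h1] at this
        exact this.symm
      have hrD : M.eRk D = 2 := by
        have h : M.eRk D + 1 + 1 + 1 = 5 := by rw [hr3, hr2, hr1]
        have hne : M.eRk D ≠ ⊤ := ((M.eRk_le_encard D).trans_lt (hBfin.sdiff.encard_lt_top)).ne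
        obtain ⟨n, hn⟩ := ENat.ne_top_iff_exists.1 hne
        rw [← hn] at h ⊢
        have : n + 1 + 1 + 1 = 5 := by exact_mod_cast h
        have : n = 2 := by omega
        rw [this]
        rfl
      have hDcard : D.ncard = 4 := by
        have hsub : ({x, y, z} : Set α) ⊆ B := by
          rintro w (rfl | rfl | rfl)
          · exact hx.1
          · exact hy.1
          · exact hz.1
        rw [hD, Set.ncard_sdiff hsub (Set.toFinite _), hB7, Set.ncard_insert_of_notMem (by
            rintro (rfl | rfl)
            · exact hxy rfl
            · exact hxz rfl), Set.ncard_pair hyz]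
      have := hC1 D hDE hrD
      omega
    -- the injection `x ↦ B ∖ {x}` into the top `6`-subsets
    have hinj : Set.InjOn (fun x => B \ {x}) ((hBfin.toFinset.filter (fun x => M.eRk (B \ {x}) = 5)) : Set α) := by
      intro x hx y hy hxy
      simp only [Finset.coe_filter, Set.Finite.mem_toFinset, Set.mem_setOf_eq] at hx hy
      have hxy' : B \ {x} = B \ {y} := hxy
      by_contra hne
      have : x ∈ B \ {y} := ⟨hx.1, fun h => hne (Set.mem_singleton_iff.1 h)⟩
      rw [← hxy'] at this
      exact this.2 (Set.mem_singleton x)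
    have himg : (hBfin.toFinset.filter (fun x => M.eRk (B \ {x}) = 5)).image (fun x => B \ {x}) ⊆
        t.bipartiteAbove (fun (B : Set α) (B' : Set α) => B' ⊆ B) B := by
      intro B' hB'
      obtain ⟨x, hx, rfl⟩ := Finset.mem_image.1 hB'
      rw [Finset.mem_filter, Set.Finite.mem_toFinset] at hx
      rw [Finset.mem_bipartiteAbove, hmem_t]
      refine ⟨⟨sdiff_subset.trans hBE, ?_, hx.2, ?_⟩, sdiff_subset⟩
      · rw [Set.ncard_sdiff (Set.singleton_subset_iff.2 hx.1) (Set.finite_singleton x), Set.ncard_singleton, hB7]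
      · refine le_antisymm (M.eRk_le_eRank _) ?_
        rw [← hBs]
        exact M.eRk_mono (Set.sdiff_subset_sdiff_right sdiff_subset)
    calc 5 ≤ (hBfin.toFinset.filter (fun x => M.eRk (B \ {x}) = 5)).card := hgood
      _ = ((hBfin.toFinset.filter (fun x => M.eRk (B \ {x}) = 5)).image (fun x => B \ {x})).card :=
          (Finset.card_image_of_injOn hinj).symm
      _ ≤ _ := Finset.card_le_card himg
  · -- each top `6`-set extends to at most two top `7`-sets
    intro B' hB'
    obtain ⟨hB'E, hB'6, hB'5, -⟩ := (hmem_t B').1 hB'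
    have hB'fin : B'.Finite := hEfin.subset hB'E
    have hcl : (M.closure B' \ B').ncard ≤ 2 := by
      have h8 := hflat (M.closure B') (M.closure_subset_ground B') (by rw [M.eRk_closure_eq]; exact hB'5.le)
      have hsub : B' ⊆ M.closure B' := M.subset_closure B' hB'E
      have := Set.ncard_sdiff hsub hB'fin
      omega
    have hsub : ((s.bipartiteBelow (fun (B : Set α) (B' : Set α) => B' ⊆ B) B' : Finset (Set α)) : Set (Set α)) ⊆
        {B : Set α | B ⊆ M.E ∧ B.ncard = 7 ∧ B' ⊆ B ∧ B ⊆ M.closure B'} := by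
      intro B hB
      rw [Finset.mem_coe, Finset.mem_bipartiteBelow] at hB
      obtain ⟨hBs, hB'B⟩ := hB
      obtain ⟨hBE, hB7, hB5, -⟩ := (hmem_s B).1 hBs
      refine ⟨hBE, hB7, hB'B, ?_⟩
      -- `ρ(B) = ρ(B')` so `B ⊆ cl B'`
      have hcleq := (M.isRkFinite_set B').closure_eq_closure_of_subset_of_eRk_ge_eRk hB'B (by rw [hB5, hB'5])
      rw [hcleq]
      exact M.subset_closure B hBE
    -- `B ↦ B ∖ B'` injects into the singletons of `cl B' ∖ B'`
    have hinj2 : {B : Set α | B ⊆ M.E ∧ B.ncard = 7 ∧ B' ⊆ B ∧ B ⊆ M.closure B'}.ncard ≤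
        {X : Set α | X ⊆ M.closure B' \ B' ∧ X.ncard = 1}.ncard := by
      refine Set.ncard_le_ncard_of_injOn (fun B : Set α => B \ B') ?_ ?_
        ((M.ground_finite.subset (M.closure_subset_ground B')).sdiff.finite_subsets.subset (fun X hX => hX.1))
      · rintro B ⟨hBE, hB7, hB'B, hBcl⟩
        refine ⟨sdiff_subset_sdiff_left hBcl, ?_⟩
        show (B \ B').ncard = 1
        rw [Set.ncard_sdiff hB'B hB'fin, hB7, hB'6]
      · rintro B₁ ⟨-, -, h₁, -⟩ B₂ ⟨-, -, h₂, -⟩ hEq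
        simp only at hEq
        rw [← Set.sdiff_union_of_subset h₁, ← Set.sdiff_union_of_subset h₂, hEq]
    calc (s.bipartiteBelow (fun (B : Set α) (B' : Set α) => B' ⊆ B) B').card
        = ((s.bipartiteBelow (fun (B : Set α) (B' : Set α) => B' ⊆ B) B' : Finset (Set α)) : Set (Set α)).ncard :=
          (Set.ncard_coe_finset _).symm
      _ ≤ {B : Set α | B ⊆ M.E ∧ B.ncard = 7 ∧ B' ⊆ B ∧ B ⊆ M.closure B'}.ncard :=
          Set.ncard_le_ncard hsub (hEfin.finite_subsets.subset (fun B hB => hB.1))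
      _ ≤ {X : Set α | X ⊆ M.closure B' \ B' ∧ X.ncard = 1}.ncard := hinj2
      _ = (M.closure B' \ B').ncard.choose 1 :=
          ncard_subsets_ncard_eq _ (M.ground_finite.subset (M.closure_subset_ground B')).sdiff 1
      _ ≤ 2 := by rw [Nat.choose_one_right]; exact hcl

end S2

end PercRepro
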